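import Literature.AlgebraicGeometry.GroupSchemes.WeilGluingStageStep
import Literature.AlgebraicGeometry.GroupSchemes.GroupLawOfSaturatedStage
import Literature.AlgebraicGeometry.GroupSchemes.StageSaturateOfRightDivDense
import Literature.AlgebraicGeometry.GroupSchemes.GroupChunkOfGluing
import Literature.AlgebraicGeometry.Smoothening.SmoothSectionsDense
import Mathlib.AlgebraicGeometry.Noetherian
import HarnessLib

/-!
# Weil's group-chunk theorem over a strictly local base (Artin, *Néron models*, Thm. (1.12), §2)

Topic `Literature/AlgebraicGeometry/GroupSchemes`, namespace `Literature.AlgebraicGeometry.GroupSchemes`.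
KERNEL ONLY: theorems; no definition, no named fact, no instance, no `sorry`.  Cell `hodgecm-mathlib` (D-0151),
road W (Néron capital): the HEAD `hW1` of the sub-line `koizumi_strictly_local` (the binder of ★
`Literature.NumberTheory.DiophantineGeometry.koizumiStrictlyLocal_of_v6`), composed from the cell's (W1) leaves —
texts of the probe `W1cProbe-v6` INLINED:

* `weilGluing_stageSaturated` — Artin's noetherian induction ([Artin1986NeronModels] §2, proof of Thm. (1.12)):
  iterate the gluing step ★ `weilGluing_stageStep` while some section `s` has `𝒳 × s ⊄ W` (the measure, an open of
  the NOETHERIAN `𝒳 ×_S 𝒳`, strictly increases); when none does, the stage is saturated by ★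
  `BirationalGroupLaw.toRationalMap_domain_eq_top_of_strict` (B-p21, Artin's «`c = a(bx⁻¹)`» paragraph).
* `weilGluing` — on a saturated stage the law is everywhere defined, associative, with isomorphic shears
  ([Artin1986NeronModels] Lemma 2.5 = ★ `groupLawOfSaturated`, A-p14), extending `L`.
* `weilGroupChunk_of_denseSections` — hence a group-chunk SOLUTION of `L` (★ `groupChunkOfGluing`, A-p14:
  the everywhere-defined associative law with isomorphic shears and a point is a group, [EdixhovenRomagny] Thm. 3.18).
* `weilGroupChunk_strictlyLocal` — over a complete discrete valuation ring with algebraically closed residue field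
  sections are dense in every fibre (★ `Smoothening.exists_section_apply_mem_fibre`, B-p07), so every STRICT
  birational group law on a smooth separated quasi-compact `R`-scheme with geometrically irreducible fibres has a
  group-chunk solution: [Artin1986NeronModels] Thm. (1.12) (i) / [BLRNeronModels1990] §5.1 Thm. 5 over a strictly
  local base.

[Artin1986NeronModels] M. Artin, *Néron models*, in Cornell–Silverman, *Arithmetic Geometry* (1986), Thm. (1.12) and
§2 (pp. 217, 221–223; held `book:cornellnd-arithmetic-geometry`).  HC_CM is not proved here; nothing here changes the
floor (road W is Néron capital; `h21` closed by E-ST).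

## References
* [Artin1986NeronModels] M. Artin, *Néron models*, in *Arithmetic Geometry* (Cornell, Silverman eds.), Springer 1986.
* [EdixhovenRomagny] B. Edixhoven, M. Romagny, *Group schemes out of birational group laws, Néron models*, Panor. Synthèses 47 (2015), §3.
* [BLRNeronModels1990] S. Bosch, W. Lütkebohmert, M. Raynaud, *Néron Models*, Springer 1990, §5.1.
-/

noncomputable section

namespace Literature.AlgebraicGeometry.GroupSchemes

open CategoryTheory CategoryTheory.Limits _root_.AlgebraicGeometry MonoidalCategory CartesianMonoidalCategory
  TopologicalSpace
open MonObj GrpObj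
open scoped CategoryTheory.Obj

universe u

variable {R : Type u} [CommRing R] [IsDomain R] [IsDiscreteValuationRing R]

/-- **Artin's noetherian induction** ([Artin1986NeronModels] §2, proof of Thm. (1.12): «by noetherian induction we
may assume `V × s ⊂ W` for all sections `s` of `V`.  Then `W = V²`»).  From the gluing STEP (★ `weilGluing_stageStep`) and the SATURATION (★ `BirationalGroupLaw.toRationalMap_domain_eq_top_of_strict`): a strict birational group law `L` on a
smooth separated quasi-compact `𝒳 → Spec R` with geometrically irreducible fibres and fibrewise-dense sections
embeds (`j : 𝒳 ↪ 𝒱` open immersion, fibrewise dense) into a stage `𝒱` with a strict law extending `L` on which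
the rational map `(a, b) ↦ j(a b) : 𝒳 ×_S 𝒳 ⤏ 𝒱` is EVERYWHERE defined.
[cite: Artin1986NeronModels, §2, proof of Thm. (1.12) (pp. 222–223)] -/
theorem weilGluing_stageSaturated
    (𝒳 : Over (Spec (.of R))) [Smooth 𝒳.hom] [IsSeparated 𝒳.hom] [QuasiCompact 𝒳.hom]
    [GeometricallyIrreducible 𝒳.hom]
    (hsec : ∀ (x : 𝒳.left) (Ω : 𝒳.left.Opens), x ∈ Ω →
      ∃ a : Spec (.of R) ⟶ 𝒳.left, a ≫ 𝒳.hom = 𝟙 _ ∧ ∃ t : Spec (.of R), a.base t ∈ Ω ∧ 𝒳.hom.base (a.base t) = 𝒳.hom.base x)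
    (L : BirationalGroupLaw 𝒳) (hL : L.IsStrict) :
    ∃ (𝒱 : Over (Spec (.of R))) (j : 𝒳 ⟶ 𝒱) (L' : BirationalGroupLaw 𝒱),
      Smooth 𝒱.hom ∧ IsSeparated 𝒱.hom ∧ QuasiCompact 𝒱.hom ∧ GeometricallyIrreducible 𝒱.hom ∧
      IsOpenImmersion j.left ∧ IsFibrewiseDense 𝒱.hom (Set.range j.left.base) ∧ L'.IsStrict ∧
      (∃ φ : (L.dom : Scheme.{u}) ⟶ (L'.dom : Scheme.{u}),
        φ ≫ L'.dom.ι = L.dom.ι ≫ (j ⊗ₘ j).left ∧ φ ≫ L'.mul = L.mul ≫ j.left) ∧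
      (Scheme.PartialMap.toRationalMap
          (⟨L.dom, L.dense_dom.dense, L.mul ≫ j.left⟩ : Scheme.PartialMap (𝒳 ⊗ 𝒳).left 𝒱.left)).domain = ⊤ := by
  -- `𝒳 ×_S 𝒳` is a noetherian topological space
  haveI : Smooth (fst 𝒳 𝒳).left := by change Smooth (pullback.fst 𝒳.hom 𝒳.hom); infer_instance
  haveI : QuasiCompact (fst 𝒳 𝒳).left := by change QuasiCompact (pullback.fst 𝒳.hom 𝒳.hom); infer_instance
  haveI : Smooth (𝒳 ⊗ 𝒳).hom := by rw [← Over.w (fst 𝒳 𝒳)]; infer_instance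
  haveI : QuasiCompact (𝒳 ⊗ 𝒳).hom := by rw [← Over.w (fst 𝒳 𝒳)]; infer_instance
  haveI : IsLocallyNoetherian (𝒳 ⊗ 𝒳).left := LocallyOfFiniteType.isLocallyNoetherian (𝒳 ⊗ 𝒳).hom
  haveI : CompactSpace ↑(𝒳 ⊗ 𝒳).left := QuasiCompact.compactSpace_of_compactSpace (𝒳 ⊗ 𝒳).hom
  haveI : IsNoetherian (𝒳 ⊗ 𝒳).left := {}
  haveI : NoetherianSpace ↑(𝒳 ⊗ 𝒳).left := inferInstance
  haveI : GeometricallyIrreducible (𝒳 ⊗ 𝒳).hom := geometricallyIrreducible_tensorObj_hom 𝒳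
  haveI : IsIntegral 𝒳.left := isIntegral_left_of_smooth_of_geometricallyIrreducible 𝒳
  haveI : IsIntegral (𝒳 ⊗ 𝒳).left := isIntegral_left_of_smooth_of_geometricallyIrreducible (𝒳 ⊗ 𝒳)
  -- the stage predicate and the induction on the measure
  have key : ∀ (U : (𝒳 ⊗ 𝒳).left.Opens) (𝒱 : Over (Spec (.of R))) (j : 𝒳 ⟶ 𝒱) (L' : BirationalGroupLaw 𝒱),
      Smooth 𝒱.hom → IsSeparated 𝒱.hom → QuasiCompact 𝒱.hom → GeometricallyIrreducible 𝒱.hom →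
      IsOpenImmersion j.left → IsFibrewiseDense 𝒱.hom (Set.range j.left.base) → L'.IsStrict →
      (∃ φ : (L.dom : Scheme.{u}) ⟶ (L'.dom : Scheme.{u}),
        φ ≫ L'.dom.ι = L.dom.ι ≫ (j ⊗ₘ j).left ∧ φ ≫ L'.mul = L.mul ≫ j.left) →
      (Scheme.PartialMap.toRationalMap
          (⟨L.dom, L.dense_dom.dense, L.mul ≫ j.left⟩ : Scheme.PartialMap (𝒳 ⊗ 𝒳).left 𝒱.left)).domain = U →
      ∃ (𝒱 : Over (Spec (.of R))) (j : 𝒳 ⟶ 𝒱) (L' : BirationalGroupLaw 𝒱),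
        Smooth 𝒱.hom ∧ IsSeparated 𝒱.hom ∧ QuasiCompact 𝒱.hom ∧ GeometricallyIrreducible 𝒱.hom ∧
        IsOpenImmersion j.left ∧ IsFibrewiseDense 𝒱.hom (Set.range j.left.base) ∧ L'.IsStrict ∧
        (∃ φ : (L.dom : Scheme.{u}) ⟶ (L'.dom : Scheme.{u}),
          φ ≫ L'.dom.ι = L.dom.ι ≫ (j ⊗ₘ j).left ∧ φ ≫ L'.mul = L.mul ≫ j.left) ∧
        (Scheme.PartialMap.toRationalMap
            (⟨L.dom, L.dense_dom.dense, L.mul ≫ j.left⟩ : Scheme.PartialMap (𝒳 ⊗ 𝒳).left 𝒱.left)).domain = ⊤ := by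
    intro U
    induction U using WellFoundedGT.induction with
    | ind U ih =>
      intro 𝒱 j L' hsm hsep hqc hgi hj hjd hL' hφ hU
      haveI := hsm; haveI := hsep; haveI := hqc; haveI := hgi; haveI := hj
      by_cases h : ∀ (s : Spec (.of R) ⟶ 𝒳.left) (hs : s ≫ 𝒳.hom = 𝟙 _) (x : 𝒳.left),
        (lift (𝟙 𝒳) (Over.homMk (𝒳.hom ≫ s) (by rw [Category.assoc, hs, Category.comp_id]) : 𝒳 ⟶ 𝒳)).left.base x
            ∈ (Scheme.PartialMap.toRationalMap
              (⟨L.dom, L.dense_dom.dense, L.mul ≫ j.left⟩ : Scheme.PartialMap (𝒳 ⊗ 𝒳).left 𝒱.left)).domain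
      · -- saturated: (G3b)
        haveI : 𝒱.left.IsSeparated := ⟨by
          rw [show terminal.from 𝒱.left = 𝒱.hom ≫ terminal.from _ from terminal.hom_ext _ _]; infer_instance⟩
        exact ⟨𝒱, j, L', hsm, hsep, hqc, hgi, hj, hjd, hL', hφ,
          L.toRationalMap_domain_eq_top_of_strict j hL hsec h⟩
      · push Not at h
        obtain ⟨s, hs, x, hx⟩ := h
        obtain ⟨φ, hφ₁, hφ₂⟩ := hφ
        obtain ⟨𝒲, j'', L'', hWsm, hWsep, hWqc, hWgi, hj'', hj''d, hL'', hφ'', hlt⟩ :=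
          weilGluing_stageStep R 𝒳 hsec L hL 𝒱 j L' hjd hL' φ hφ₁ hφ₂ s hs x hx
        exact ih _ (hU ▸ hlt) 𝒲 j'' L'' hWsm hWsep hWqc hWgi hj'' hj''d hL'' hφ'' rfl
  -- INIT: `𝒳` itself with `j = 𝟙`, `L′ = L`
  refine key _ 𝒳 (𝟙 𝒳) L inferInstance inferInstance inferInstance inferInstance
    (by change IsOpenImmersion (𝟙 𝒳.left); infer_instance) ?_ hL ⟨𝟙 _, ?_, ?_⟩ rfl
  · have : Set.range (𝟙 𝒳 : 𝒳 ⟶ 𝒳).left.base = Set.univ := by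
      change Set.range (𝟙 𝒳.left : 𝒳.left ⟶ 𝒳.left).base = Set.univ
      exact Set.range_eq_univ.mpr fun x => ⟨x, rfl⟩
    rw [this]; exact IsFibrewiseDense.univ _
  · rw [MonoidalCategory.id_tensorHom_id]; change L.dom.ι = L.dom.ι ≫ 𝟙 _; rw [Category.comp_id]
  · change L.mul = L.mul ≫ 𝟙 _; rw [Category.comp_id]

/-- **Weil's gluing** ([Artin1986NeronModels] §2, Lemmas 2.4–2.5 and the proof of Thm. (1.12)): a STRICT birational
group law `L` on a smooth separated quasi-compact `𝒳 → Spec R` with geometrically irreducible fibres and sections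
dense in every fibre is an open immersion, over `S`, with fibrewise-dense image, into a smooth separated quasi-compact
`S`-scheme `𝒢` carrying an everywhere-defined ASSOCIATIVE multiplication with ISOMORPHIC shears which extends the
partial law.  (Stage construction `weilGluing_stageSaturated` + [Artin1986NeronModels] Lemma 2.5 = ★ `groupLawOfSaturated`.)
[cite: Artin1986NeronModels, Thm. (1.12) and §2 (pp. 221–223)] [cite: EdixhovenRomagny, Thm. 3.18] -/
theorem weilGluing
    (𝒳 : Over (Spec (.of R))) [Smooth 𝒳.hom] [IsSeparated 𝒳.hom] [QuasiCompact 𝒳.hom]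
    [GeometricallyIrreducible 𝒳.hom]
    (hsec : (∀ (x : 𝒳.left) (Ω : 𝒳.left.Opens), x ∈ Ω →
      ∃ a : Spec (.of R) ⟶ 𝒳.left, a ≫ 𝒳.hom = 𝟙 _ ∧ ∃ t : Spec (.of R), a.base t ∈ Ω ∧ 𝒳.hom.base (a.base t) = 𝒳.hom.base x))
    (L : BirationalGroupLaw 𝒳) (hL : L.IsStrict) :
    ∃ (𝒢 : Over (Spec (.of R))) (i : 𝒳 ⟶ 𝒢) (m : 𝒢 ⊗ 𝒢 ⟶ 𝒢),
      Smooth 𝒢.hom ∧ IsSeparated 𝒢.hom ∧ QuasiCompact 𝒢.hom ∧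
      IsOpenImmersion i.left ∧ IsFibrewiseDense 𝒢.hom (Set.range i.left.base) ∧
      (∀ {T : Over (Spec (.of R))} (a b c : T ⟶ 𝒢), lift (lift a b ≫ m) c ≫ m = lift a (lift b c ≫ m) ≫ m) ∧
      IsIso (lift (fst 𝒢 𝒢) m) ∧ IsIso (lift m (snd 𝒢 𝒢)) ∧
      L.mul ≫ i.left = L.dom.ι ≫ (i ⊗ₘ i).left ≫ m.left := by
  obtain ⟨𝒱, j, L', hsm, hsep, hqc, hgi, hj, hjd, hL', hφ, htop⟩ :=
    weilGluing_stageSaturated 𝒳 hsec L hL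
  obtain ⟨m, hassoc, hΦ, hΨ, hcomp⟩ :=
    groupLawOfSaturated R 𝒳 hsec L hL 𝒱 j L' ⟨hsm, hsep, hqc, hgi, hj, hjd, hL', hφ⟩ htop
  exact ⟨𝒱, j, m, hsm, hsep, hqc, hj, hjd, hassoc, hΦ, hΨ, hcomp⟩

/-- **Weil's group-chunk theorem, dense-sections form** ([Artin1986NeronModels] Thm. (1.12); [EdixhovenRomagny]
Thm. 3.18; [BLRNeronModels1990] Thm. 5.1/5): under the hypotheses of `weilGluing`, `L` has a group-chunk SOLUTION
(★ `IsGroupChunkSolution`: an open immersion `j : 𝒳 ↪ G` over `S` into a smooth separated quasi-compact `S`-GROUP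
scheme, fibrewise dense, carrying `mul` to the group law, with `(a, b) ↦ j(a) j(b)⁻¹` surjective) — Weil's gluing
followed by ★ `groupChunkOfGluing` (the everywhere-defined associative law with isomorphic shears and a point is a
group). [cite: Artin1986NeronModels, Thm. (1.12)] [cite: EdixhovenRomagny, Thm. 3.18] [cite: BLRNeronModels1990, §5.1 Thm. 5] -/
theorem weilGroupChunk_of_denseSections
    (𝒳 : Over (Spec (.of R))) [Smooth 𝒳.hom] [IsSeparated 𝒳.hom] [QuasiCompact 𝒳.hom]
    [GeometricallyIrreducible 𝒳.hom]
    (hsec : (∀ (x : 𝒳.left) (Ω : 𝒳.left.Opens), x ∈ Ω →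
      ∃ a : Spec (.of R) ⟶ 𝒳.left, a ≫ 𝒳.hom = 𝟙 _ ∧ ∃ t : Spec (.of R), a.base t ∈ Ω ∧ 𝒳.hom.base (a.base t) = 𝒳.hom.base x))
    (L : BirationalGroupLaw 𝒳) (hL : L.IsStrict) :
    ∃ (G : Over (Spec (.of R))) (_ : GrpObj G) (j : 𝒳 ⟶ G),
      Smooth G.hom ∧ IsSeparated G.hom ∧ QuasiCompact G.hom ∧ IsGroupChunkSolution L G j := by
  obtain ⟨𝒢, i, m, hsm, hsep, hqc, hi, hd, hassoc, hΦ, hΨ, hcomp⟩ := weilGluing 𝒳 hsec L hL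
  have hirr : ∀ t : Spec (.of R), IsPreirreducible (𝒳.hom.base ⁻¹' {t}) := fun t =>
    (𝒳.hom.isIrreducible_preimage 𝒳.hom.isOpenMap isIrreducible_singleton).isPreirreducible
  haveI : IrreducibleSpace 𝒳.left := GeometricallyIrreducible.irreducibleSpace 𝒳.hom 𝒳.hom.isOpenMap
  obtain ⟨a, ha, -⟩ := hsec (Classical.arbitrary 𝒳.left) ⊤ trivial
  obtain ⟨inst, j, -, hsol⟩ := groupChunkOfGluing ⟨a, ha⟩ hirr L 𝒢 i m hi hd hassoc hΦ hΨ hcomp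
  exact ⟨𝒢, inst, j, hsm, hsep, hqc, hsol⟩

/-- **Weil's group-chunk theorem over a strictly local base** ([Artin1986NeronModels] Thm. (1.12), case (i), with the
dense local sections of a smooth surjective scheme over a complete discrete valuation ring with algebraically closed
residue field, ★ `Smoothening.exists_section_apply_mem_fibre`; [BLRNeronModels1990] Thm. 5.1/5 over a strictly
henselian base): a STRICT birational group law on a smooth separated quasi-compact `R`-scheme with geometrically
irreducible fibres has a group-chunk solution.  This is the head `hW1` of the cell's road W (W1cProbe-v6
`WeilGroupChunkStrictlyLocal`). [cite: Artin1986NeronModels, Thm. (1.12)] [cite: BLRNeronModels1990, §5.1 Thm. 5]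
[cite: EdixhovenRomagny, Thm. 3.18] -/
theorem weilGroupChunk_strictlyLocal
    [IsAdicComplete (IsLocalRing.maximalIdeal R) R] (hk : IsAlgClosed (IsLocalRing.ResidueField R))
    (𝒳 : Over (Spec (.of R))) [Smooth 𝒳.hom] [IsSeparated 𝒳.hom] [QuasiCompact 𝒳.hom]
    [GeometricallyIrreducible 𝒳.hom] (L : BirationalGroupLaw 𝒳) (hL : L.IsStrict) :
    ∃ (G : Over (Spec (.of R))) (_ : GrpObj G) (j : 𝒳 ⟶ G),
      Smooth G.hom ∧ IsSeparated G.hom ∧ QuasiCompact G.hom ∧ IsGroupChunkSolution L G j := by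
  have hirr : ∀ t : Spec (.of R), IsPreirreducible (𝒳.hom.base ⁻¹' {t}) := fun t =>
    (𝒳.hom.isIrreducible_preimage 𝒳.hom.isOpenMap isIrreducible_singleton).isPreirreducible
  exact weilGroupChunk_of_denseSections 𝒳
    (Literature.AlgebraicGeometry.Smoothening.exists_section_apply_mem_fibre R hk 𝒳 inferInstance hirr) L hL

end Literature.AlgebraicGeometry.GroupSchemes

end
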